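import Summits.QuantumFields.YangMills.Theorems.LangevinControlUVOSLegsFromFemtoAndGapStubAssemblyRPExpansion
import HarnessLib

/-!
# Soft OS-assembly toolkit XIX: reindexing the reflection-positivity square (reversal + reflected sites)

Helper file for stub `stub_assembly6` of crux `OSLegsFromFemtoAndGap` (stmt-QuantumFields-9367, line
`dlr-collar-transfer`, reshape r2).  Toolkit XVIII expanded the square into `Σ conj Fᵢ(a x) Fⱼ(a y) W(θ̃x ++ y)`.
Here the first block is reversed (`rev`: the OS adjoint reverses the arguments; the string weights are symmetric under
the joint permutation, `torusMomentStr_comp_perm` with the permutation `revFirst` acting as `rev` on the first block)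
and the reflected sites are taken as the new summation variables (`θ̃` is an involution; for test functions with
time support in `(0, T]` and `T < a L` every non-vanishing term has its sites and its reflected sites inside the box),
giving `Σ_{q,p} Σ_{x',y} W(x' ++ y) · conj Fᵢ(θ(a x'∘rev) + c) Fⱼ(a y)` with the constant ORIENTATION-DEPENDENT
shift `c_l = a (1 − [q'(rev l) temporal]) e₀` (`rpTerm_eq_shifted`): the reflection-positivity square is the OS
form at points shifted by at most one lattice unit.
-/

noncomputable section

open scoped SchwartzMap BigOperators ComplexConjugate
open MeasureTheory Filter Topology
open Literature.MathematicalPhysics.QuantumFieldTheory Literature.MathematicalPhysics.QuantumLattice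
open Literature.MathematicalPhysics.AQFT
open Literature.Probability.LatticeModels (box Site mem_box)

namespace Summit.QuantumFields.YangMills.Theorems.OSLegsFromFemtoAndGap

local notation "E4" => EuclideanSpace ℝ (Fin 4)

/-! ### The permutation reversing the first block -/

/-- The permutation of `Fin (n + k)` acting as `Fin.rev` on the first `n` indices and trivially on the last `k`. -/
def revFirst (n k : ℕ) : Equiv.Perm (Fin (n + k)) :=
  finSumFinEquiv.symm.trans ((Equiv.sumCongr Fin.revPerm (Equiv.refl (Fin k))).trans finSumFinEquiv)

/-- `revFirst` on the first block. -/
theorem revFirst_castAdd (n k : ℕ) (i : Fin n) : revFirst n k (Fin.castAdd k i) = Fin.castAdd k (Fin.rev i) := by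
  simp [revFirst]

/-- `revFirst` on the second block. -/
theorem revFirst_natAdd (n k : ℕ) (j : Fin k) : revFirst n k (Fin.natAdd n j) = Fin.natAdd n j := by
  simp [revFirst]

/-- Appended tuples precomposed with `revFirst`: the first block is reversed. -/
theorem append_comp_revFirst {α : Type*} {n k : ℕ} (u : Fin n → α) (v : Fin k → α) :
    Fin.append u v ∘ revFirst n k = Fin.append (u ∘ Fin.rev) v := by
  funext l
  induction l using Fin.addCases with
  | left i => simp [revFirst_castAdd]
  | right j => simp [revFirst_natAdd]

/-! ### Reversal-invariant index sets -/

/-- A constant-fibre `piFinset` is stable under precomposition with a permutation. -/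
theorem comp_perm_mem_piFinset {α : Type*} {n : ℕ} {s : Finset α} {x : Fin n → α}
    (hx : x ∈ Fintype.piFinset (fun _ : Fin n => s)) (σ : Equiv.Perm (Fin n)) :
    x ∘ σ ∈ Fintype.piFinset (fun _ : Fin n => s) := by
  rw [Fintype.mem_piFinset] at hx ⊢
  exact fun i => hx _

/-- Reindexing a sum over a constant-fibre `piFinset` by precomposition with a permutation. -/
theorem sum_piFinset_comp_perm {α M : Type*} [AddCommMonoid M] {n : ℕ} (s : Finset α) (σ : Equiv.Perm (Fin n))
    (f : (Fin n → α) → M) :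
    ∑ x ∈ Fintype.piFinset (fun _ : Fin n => s), f (x ∘ σ) = ∑ x ∈ Fintype.piFinset (fun _ : Fin n => s), f x := by
  refine Finset.sum_bij' (fun x _ => x ∘ σ) (fun x _ => x ∘ σ.symm) (fun x hx => comp_perm_mem_piFinset hx σ)
    (fun x hx => comp_perm_mem_piFinset hx σ.symm) (fun x _ => ?_) (fun x _ => ?_) (fun x _ => rfl)
  · funext i; simp
  · funext i; simp

/-! ### The reflected sites in physical units -/

/-- **Reflected sites in physical units**: `a · θ̃_q x = θ(a · x) + a (1 − [q temporal]) e₀`. -/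
theorem smul_siteToE_thetaSite (a : ℝ) (q : Fin 4 × Fin 4) (x : Site 4) :
    a • siteToE (thetaSite q x) =
      timeReflection 4 (a • siteToE x) + (a * (1 - if q.1 = 0 then 1 else 0)) • siteToE (Pi.single (0 : Fin 4) (1 : ℤ)) := by
  ext k
  rw [PiLp.smul_apply, siteToE_apply, PiLp.add_apply, PiLp.smul_apply, timeReflection_apply, PiLp.smul_apply,
    siteToE_apply, siteToE_apply]
  by_cases hk : k = 0
  · subst hk
    rw [thetaSite_apply_zero, if_pos rfl, Pi.single_eq_same]
    simp only [smul_eq_mul]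
    split_ifs <;> push_cast <;> ring
  · rw [thetaSite_apply_of_ne q x hk, if_neg hk, Pi.single_eq_of_ne hk]
    simp

/-! ### The change of variables -/

variable {G : Type} [Group G] [TopologicalSpace G] [IsTopologicalGroup G] [CompactSpace G]
  [MeasurableSpace G] [BorelSpace G]

/-- Sites of the box with a non-positive or a too-large time coordinate kill a test function with time support
in `(0, T]`, `T < a (L+1)`: the two vanishing conditions used in the change of variables. -/
theorem apply_eq_zero_of_time {n : ℕ} {a T : ℝ} (ha : 0 < a) (F : 𝓢((Fin n → E4), ℂ))
    (hF : ∀ u : Fin n → E4, (∃ l, u l 0 ≤ 0 ∨ T < u l 0) → F u = 0) (x : Fin n → Site 4)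
    (hx : ∃ l, x l 0 ≤ 0 ∨ T < a * x l 0) : F (fun l => a • siteToE (x l)) = 0 := by
  obtain ⟨l, hl⟩ := hx
  refine hF _ ⟨l, ?_⟩
  rw [PiLp.smul_apply, siteToE_apply, smul_eq_mul]
  rcases hl with h | h
  · left; have : (x l 0 : ℝ) ≤ 0 := by exact_mod_cast h
    nlinarith
  · right; exact h

/-- **The change of variables `x' = θ̃ x̂`** for one reversed term: for a test function with time support in
`(0, T]`, `T < a L`, summing `G(a x̂) · Φ(θ̃ x̂)` over the box equals summing `G(a θ̃x') · Φ(x')` over the box. -/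
theorem sum_thetaSite_eq {n : ℕ} {a T : ℝ} (ha : 0 < a) {L : ℕ} (hTL : T < a * L)
    (Gf : (Fin n → E4) → ℂ) (hG : ∀ u : Fin n → E4, (∃ l, u l 0 ≤ 0 ∨ T < u l 0) → Gf u = 0)
    (q : Fin n → Fin 4 × Fin 4) (Φ : (Fin n → Site 4) → ℂ) :
    ∑ x ∈ Fintype.piFinset (fun _ : Fin n => box 4 L), Gf (fun l => a • siteToE (x l)) * Φ (fun l => thetaSite (q l) (x l)) =
      ∑ x ∈ Fintype.piFinset (fun _ : Fin n => box 4 L),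
        Gf (fun l => a • siteToE (thetaSite (q l) (x l))) * Φ x := by
  classical
  -- both sums live on the set where `Gf ≠ 0`; there `x̂` and `θ̃x̂` are both in the box
  have hTL1 : T < a * ((L : ℝ) + 1) := by nlinarith
  have key : ∀ x : Fin n → Site 4, Gf (fun l => a • siteToE (x l)) ≠ 0 →
      (x ∈ Fintype.piFinset (fun _ : Fin n => box 4 L) ↔
        (fun l => thetaSite (q l) (x l)) ∈ Fintype.piFinset (fun _ : Fin n => box 4 L)) := by
    intro x hx
    have htime : ∀ l, 1 ≤ x l 0 ∧ a * x l 0 ≤ T := by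
      intro l
      by_contra h
      refine hx (hG _ ⟨l, ?_⟩)
      rw [PiLp.smul_apply, siteToE_apply, smul_eq_mul]
      rcases not_and_or.1 h with h | h
      · left; have : (x l 0 : ℝ) ≤ 0 := by exact_mod_cast (show x l 0 ≤ 0 by omega)
        nlinarith
      · right; exact lt_of_not_ge h
    have hxL : ∀ l, x l 0 ≤ L := by
      intro l
      by_contra h
      have h1 : (L : ℝ) + 1 ≤ x l 0 := by exact_mod_cast (show (L : ℤ) + 1 ≤ x l 0 by omega)
      have := (htime l).2
      nlinarith
    simp only [Fintype.mem_piFinset, mem_box]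
    constructor
    · intro h l k
      by_cases hk : k = 0
      · subst hk; rw [thetaSite_apply_zero]
        have := (htime l).1; have := hxL l
        split_ifs <;> constructor <;> omega
      · rw [thetaSite_apply_of_ne _ _ hk]; exact h l k
    · intro h l k
      by_cases hk : k = 0
      · subst hk; have := (htime l).1; have := hxL l; constructor <;> omega
      · have := h l k; rwa [thetaSite_apply_of_ne _ _ hk] at this
  -- the involution
  have hinv : ∀ x : Fin n → Site 4, (fun l => thetaSite (q l) (thetaSite (q l) (x l))) = x := fun x =>
    funext fun l => thetaSite_thetaSite _ _
  -- restrict both sides to the non-vanishing set and use the bijection `θ̃`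
  rw [← Finset.sum_filter_ne_zero (s := Fintype.piFinset (fun _ : Fin n => box 4 L)),
    ← Finset.sum_filter_ne_zero (s := Fintype.piFinset (fun _ : Fin n => box 4 L))
      (f := fun x => Gf (fun l => a • siteToE (thetaSite (q l) (x l))) * Φ x)]
  refine Finset.sum_bij' (fun x _ => fun l => thetaSite (q l) (x l)) (fun x _ => fun l => thetaSite (q l) (x l))
    (fun x hx => ?_) (fun x hx => ?_) (fun x _ => hinv x) (fun x _ => hinv x)
    (fun x _ => by simp only [thetaSite_thetaSite])
  · rw [Finset.mem_filter] at hx ⊢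
    have hG0 : Gf (fun l => a • siteToE (x l)) ≠ 0 := fun h => hx.2 (by rw [h, zero_mul])
    refine ⟨(key x hG0).1 hx.1, ?_⟩
    simp only [thetaSite_thetaSite]
    exact hx.2
  · rw [Finset.mem_filter] at hx ⊢
    have hG0 : Gf (fun l => a • siteToE (thetaSite (q l) (x l))) ≠ 0 := fun h => hx.2 (by rw [h, zero_mul])
    refine ⟨?_, by simp only [thetaSite_thetaSite]; exact hx.2⟩
    have := (key (fun l => thetaSite (q l) (x l)) hG0).2
    simp only [thetaSite_thetaSite] at this
    exact this hx.1

/-- **The reindexed term of the reflection-positivity square.**  For a test function `Fᵢ` of the first block with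
time support in `(0, T]`, `T < a L`: the `(q, p)`-sum of toolkit XVIII equals the string sum at the ACTUAL sites with
the first block of the test function evaluated at the reflected-and-shifted physical points. -/
theorem rpTerm_eq_shifted (r : LatticeRep G) (β : ℝ) (L : ℕ) {a T : ℝ} (ha : 0 < a) (hTL : T < a * L)
    {n k : ℕ} (Fi : 𝓢((Fin n → E4), ℂ)) (hFi : ∀ u : Fin n → E4, (∃ l, u l 0 ≤ 0 ∨ T < u l 0) → Fi u = 0)
    (Fj : 𝓢((Fin k → E4), ℂ)) (m : Fin 4 × Fin 4 → ℝ) :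
    ∑ q ∈ Fintype.piFinset (fun _ : Fin n => Finset.univ.filter fun pl : Fin 4 × Fin 4 => pl.1 < pl.2),
      ∑ p ∈ Fintype.piFinset (fun _ : Fin k => Finset.univ.filter fun pl : Fin 4 × Fin 4 => pl.1 < pl.2),
      ∑ x ∈ Fintype.piFinset (fun _ : Fin n => box 4 L),
      ∑ y ∈ Fintype.piFinset (fun _ : Fin k => box 4 L),
        conj (Fi (fun l => a • siteToE (x l))) * Fj (fun l => a • siteToE (y l)) *
          (torusMomentStr r.ρ β L (fun l U => plaquetteObs r.ρ 0 (Fin.append q p l).1 (Fin.append q p l).2 U)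
            (Fin.append (fun l => m (q l)) (fun l => m (p l))) (Fin.append (fun l => thetaSite (q l) (x l)) y) : ℂ) =
    ∑ q ∈ Fintype.piFinset (fun _ : Fin n => Finset.univ.filter fun pl : Fin 4 × Fin 4 => pl.1 < pl.2),
      ∑ p ∈ Fintype.piFinset (fun _ : Fin k => Finset.univ.filter fun pl : Fin 4 × Fin 4 => pl.1 < pl.2),
      ∑ x ∈ Fintype.piFinset (fun _ : Fin n => box 4 L),
      ∑ y ∈ Fintype.piFinset (fun _ : Fin k => box 4 L),
        conj (Fi (fun l => timeReflection 4 (a • siteToE (x (Fin.rev l))) +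
            (a * (1 - if (q (Fin.rev l)).1 = 0 then 1 else 0)) • siteToE (Pi.single (0 : Fin 4) (1 : ℤ)))) *
          Fj (fun l => a • siteToE (y l)) *
          (torusMomentStr r.ρ β L (fun l U => plaquetteObs r.ρ 0 (Fin.append q p l).1 (Fin.append q p l).2 U)
            (Fin.append (fun l => m (q l)) (fun l => m (p l))) (Fin.append x y) : ℂ) := by
  classical
  -- Step 1: reverse the first block (`q ↦ q ∘ rev`, `x ↦ x ∘ rev`) — a bijection of both index sets
  rw [← sum_piFinset_comp_perm _ Fin.revPerm]
  refine Finset.sum_congr rfl fun q _ => Finset.sum_congr rfl fun p _ => ?_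
  rw [← sum_piFinset_comp_perm _ Fin.revPerm]
  -- Step 2: the weights are invariant under the joint reversal of the first block
  have hW : ∀ (x : Fin n → Site 4) (y : Fin k → Site 4),
      torusMomentStr r.ρ β L (fun l U => plaquetteObs r.ρ 0 (Fin.append (q ∘ ⇑Fin.revPerm) p l).1
          (Fin.append (q ∘ ⇑Fin.revPerm) p l).2 U)
        (Fin.append (fun l => m ((q ∘ ⇑Fin.revPerm) l)) (fun l => m (p l)))
        (Fin.append (fun l => thetaSite ((q ∘ ⇑Fin.revPerm) l) ((x ∘ ⇑Fin.revPerm) l)) y) =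
      torusMomentStr r.ρ β L (fun l U => plaquetteObs r.ρ 0 (Fin.append q p l).1 (Fin.append q p l).2 U)
        (Fin.append (fun l => m (q l)) (fun l => m (p l))) (Fin.append (fun l => thetaSite (q l) (x l)) y) := by
    intro x y
    rw [← torusMomentStr_comp_perm r.ρ β L _ _ (Fin.append (fun l => thetaSite (q l) (x l)) y) (revFirst n k)]
    congr 1
    · funext l U
      have h := congrFun (append_comp_revFirst q p) l
      simp only [Function.comp_apply] at h ⊢
      rw [h]
      rfl
    · rw [append_comp_revFirst]; rfl
    · rw [append_comp_revFirst]; rfl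
  simp_rw [hW]
  -- Step 3: exchange the `x`- and `y`-sums and change variables `x ↦ θ̃ x` in the `x`-sum
  rw [Finset.sum_comm]
  conv_rhs => rw [Finset.sum_comm]
  refine Finset.sum_congr rfl fun y _ => ?_
  have h := sum_thetaSite_eq ha hTL (fun u => conj (Fi (u ∘ Fin.rev)) * Fj (fun l => a • siteToE (y l)))
    (fun u hu => by
      obtain ⟨l, hl⟩ := hu
      beta_reduce
      rw [hFi (u ∘ Fin.rev) ⟨Fin.rev l, by simpa using hl⟩, map_zero, zero_mul]) q
    (fun x => (torusMomentStr r.ρ β L (fun l U => plaquetteObs r.ρ 0 (Fin.append q p l).1 (Fin.append q p l).2 U)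
      (Fin.append (fun l => m (q l)) (fun l => m (p l))) (Fin.append x y) : ℂ))
  refine (Finset.sum_congr rfl fun x _ => ?_).trans (h.trans (Finset.sum_congr rfl fun x _ => ?_))
  · rfl
  · congr 3
    congr 1
    funext l
    simp only [Function.comp_apply]
    exact smul_siteToE_thetaSite a _ _

end Summit.QuantumFields.YangMills.Theorems.OSLegsFromFemtoAndGap

end
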